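import Literature.Analysis.SpecialFunctions.HypergeometricKummerAtOne
import Literature.Analysis.SpecialFunctions.HypergeometricNegRealLimit
import Literature.Analysis.ODE.LinearSecondOrder
import HarnessLib

/-!
# The connection formula of `₂F₁` between `z = 0` and `z = 1` (DLMF 15.8.4 / 15.10.21)

Continuation of `HypergeometricKummerAtOne.lean` (Kummer's solutions `w₃ = kummer₃ a b c`,
`w₄ = kummer₄ a b c` at `z = 1`, their Wronskian), `HypergeometricGaussSum.lean` and
`HypergeometricEulerTransformation.lean`. With `s = c − a − b`, for `0 < Re b < Re c` (Gauss's
theorem is available through Euler's integral), `s ≠ 0` and `|Re s| < 1`, on `0 < x < 1`: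

  `₂F₁(a,b;c;x) = Γ(c)Γ(c−a−b)/(Γ(c−a)Γ(c−b)) · ₂F₁(a,b;a+b−c+1;1−x)`
  `             + Γ(c)Γ(a+b−c)/(Γ(a)Γ(b)) · (1−x)^{c−a−b} ₂F₁(c−a,c−b;c−a−b+1;1−x)`

(`ordinaryHypergeometric_connection_one`; `1/Γ = 0` at the poles is Mathlib's `Gamma (−n) = 0`).
The resonant line `Re s = 0`, `s ≠ 0` (two terms of equal modulus — the near-extremal Kerr cap
amplitudes) is INCLUDED. Proof, without contour integrals or continuation in the parameters:

* `exists_kummer_coefficients` — `₂F₁ a b c = A w₃ + B w₄` on `(0,1)` with the derivatives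
  (three solutions, `W(w₃,w₄) ≠ 0`, Cramer at `x = ½`, uniqueness `ODE.eqOn_of_solution_Ioo`);
* `connection_coeff₄` — `B` from the FIRST DERIVATIVE: `(1−x)^{1−s}·₂F₁′ = (ab/c)₂F₁(c−a,c−b;c+1;x)`
  (Euler) `→ (ab/c)Γ(c+1)Γ(1−s)/(Γ(a+1)Γ(b+1))` (Gauss, `Re s < 1`) `= lim (1−x)^{1−s}(Aw₃′+Bw₄′) = −sB`;
* `connection_coeff₃` — `A` likewise from the Euler partner `g = ₂F₁(c−a,c−b;c;x) =
  A(1−x)^{−s}w₃ + B w₃(c−a,c−b,c;x)`: `(1−x)^{1+s}g′ → (…)Γ(c+1)Γ(1+s)/(Γ(c−a+1)Γ(c−b+1)) = sA`.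

Not here: `|Re s| ≥ 1` (more derivatives), complex `z` off the segment, `s ∈ ℤ` (logarithms).

References: NIST DLMF (15.8.4), (15.10.21), (15.4.20), (15.8.1) [DLMF]; Andrews–Askey–Roy,
*Special Functions* (1999), Thm 2.3.2 [AndrewsAskeyRoy1999].
-/

noncomputable section

open Filter Metric Set Complex
open scoped Topology

namespace Literature.Analysis.SpecialFunctions.Hypergeometric

/-! ### Elementary limits at `x → 1⁻` -/

/-- `(1−x)^{p} → 0` as `x → 1⁻` for `Re p > 0` (`‖(1−x)^p‖ = (1−x)^{Re p}`). [folklore] -/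
theorem tendsto_one_sub_cpow_nhdsLT_one {p : ℂ} (hp : 0 < p.re) :
    Tendsto (fun x : ℝ => (1 - (x : ℂ)) ^ p) (𝓝[<] 1) (𝓝 0) := by
  have hc : Tendsto (fun t : ℝ => t ^ p.re) (𝓝 0) (𝓝 0) := by
    simpa [Real.zero_rpow hp.ne'] using (Real.continuousAt_rpow_const 0 p.re (Or.inr hp.le)).tendsto
  have h1 : Tendsto (fun x : ℝ => 1 - x) (𝓝[<] (1 : ℝ)) (𝓝 0) := by
    simpa using ((continuous_sub_left (1 : ℝ)).tendsto 1).mono_left nhdsWithin_le_nhds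
  refine tendsto_zero_iff_norm_tendsto_zero.2 ((hc.comp h1).congr' ?_)
  filter_upwards [self_mem_nhdsWithin] with x hx
  rw [Function.comp_apply, show (1 : ℂ) - x = ((1 - x : ℝ) : ℂ) by push_cast; ring,
    norm_cpow_eq_rpow_re_of_pos (by simpa using hx)]

/-- `0 < x < 1` real has `‖x‖ < 1` in `ℂ`. [folklore] -/
theorem norm_ofReal_lt_one_of_mem_Ioo {x : ℝ} (hx : x ∈ Ioo (0 : ℝ) 1) : ‖(x : ℂ)‖ < 1 := by
  rw [norm_real, Real.norm_eq_abs, abs_lt]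
  exact ⟨by linarith [hx.1], hx.2⟩

/-- `Re c > 0` excludes the poles `c ∈ −ℕ` (inlined). [folklore] -/
private theorem ne_neg_nat_of_re_pos'' {c : ℂ} (hc : 0 < c.re) (n : ℕ) : c ≠ -n := fun h => by
  have h' := congrArg Complex.re h
  simp at h'
  linarith [n.cast_nonneg (α := ℝ)]

/-! ### `₂F₁ a b c` in the Kummer basis at `1` -/

section Span

variable {a b c : ℂ}

/-- **`₂F₁ a b c` is a combination of Kummer's solutions at `1`** on `(0,1)`, with its derivative:
for `c, a+b−c+1, c−a−b+1 ∉ −ℕ` and `c − a − b ≠ 0` there are constants `A, B` with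
`₂F₁(a,b;c;x) = A w₃(x) + B w₄(x)`, `(ab/c)₂F₁(a+1,b+1;c+1;x) = A w₃′(x) + B w₄′(x)` on `0 < x < 1`
(three solutions of a linear equation, `W(w₃,w₄) ≠ 0`, Cramer at `½`, uniqueness). [cite: DLMF, 15.10.21] -/
theorem exists_kummer_coefficients (hcn : ∀ n : ℕ, c ≠ -n) (hγ : ∀ n : ℕ, a + b - c + 1 ≠ -n)
    (hγ' : ∀ n : ℕ, c - a - b + 1 ≠ -n) (hs : c - a - b ≠ 0) :
    ∃ A B : ℂ, ∀ x ∈ Ioo (0 : ℝ) 1,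
      ₂F₁ a b c (x : ℂ) = A * kummer₃ a b c x + B * kummer₄ a b c x ∧
      a * b / c * ₂F₁ (a + 1) (b + 1) (c + 1) (x : ℂ) =
        A * kummer₃Deriv a b c x + B * kummer₄Deriv a b c x := by
  -- the solved form `u″ = p u′ + q u` on `(0,1)`; the three solutions; Cramer at `½`; uniqueness
  set p : ℝ → ℂ := fun x => -(c - (a + b + 1) * (x : ℂ)) / ((x : ℂ) * (1 - x)) with hp
  set q : ℝ → ℂ := fun x => a * b / ((x : ℂ) * (1 - x)) with hq
  have hden : ∀ x ∈ Ioo (0 : ℝ) 1, (x : ℂ) * (1 - x) ≠ 0 := fun x hx =>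
    mul_ne_zero (ofReal_ne_zero.2 hx.1.ne') (one_sub_ofReal_ne_zero hx.2)
  have hpc : ContinuousOn p (Ioo 0 1) :=
    (Continuous.continuousOn (by fun_prop)).div (Continuous.continuousOn (by fun_prop)) hden
  have hqc : ContinuousOn q (Ioo 0 1) :=
    (Continuous.continuousOn (by fun_prop)).div (Continuous.continuousOn (by fun_prop)) hden
  have solve : ∀ x ∈ Ioo (0 : ℝ) 1, ∀ u u₁ u₂ : ℂ,
      (x : ℂ) * (1 - x) * u₂ + (c - (a + b + 1) * x) * u₁ - a * b * u = 0 →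
        u₂ = p x * u₁ + q x * u := by
    intro x hx u u₁ u₂ h
    have e : p x * u₁ + q x * u =
        (-(c - (a + b + 1) * x) * u₁ + a * b * u) / ((x : ℂ) * (1 - x)) := by
      simp only [hp, hq]; ring
    rw [e, eq_div_iff (hden x hx)]
    linear_combination h
  set F : ℝ → ℂ := fun y => ₂F₁ a b c (y : ℂ) with hF
  set F₁ : ℝ → ℂ := fun y => a * b / c * ₂F₁ (a + 1) (b + 1) (c + 1) (y : ℂ) with hF₁
  set K₃ : ℝ → ℂ := fun y => kummer₃ a b c y with hK₃
  set K₃' : ℝ → ℂ := fun y => kummer₃Deriv a b c y with hK₃'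
  set K₄ : ℝ → ℂ := fun y => kummer₄ a b c y with hK₄
  set K₄' : ℝ → ℂ := fun y => kummer₄Deriv a b c y with hK₄'
  have solF : ∀ x ∈ Ioo (0 : ℝ) 1, HasDerivAt F (F₁ x) x ∧
      HasDerivAt F₁ (p x * F₁ x + q x * F x) x := by
    intro x hx
    obtain ⟨h1, h2, h3⟩ := ordinaryHypergeometric_ode_hasDerivAt hcn (norm_ofReal_lt_one_of_mem_Ioo hx)
    exact ⟨h1.comp_ofReal, h2.comp_ofReal.congr_deriv (solve x hx _ _ _ h3)⟩
  have sol3 : ∀ x ∈ Ioo (0 : ℝ) 1, HasDerivAt K₃ (K₃' x) x ∧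
      HasDerivAt K₃' (p x * K₃' x + q x * K₃ x) x := by
    intro x hx
    have hn := norm_one_sub_ofReal_lt_one hx
    exact ⟨(hasDerivAt_kummer₃ a b c hn).comp_ofReal,
      (hasDerivAt_kummer₃Deriv a b c hn).comp_ofReal.congr_deriv
        (solve x hx _ _ _ (kummer₃_ode hγ hn))⟩
  have sol4 : ∀ x ∈ Ioo (0 : ℝ) 1, HasDerivAt K₄ (K₄' x) x ∧
      HasDerivAt K₄' (p x * K₄' x + q x * K₄ x) x := by
    intro x hx
    have hn := norm_one_sub_ofReal_lt_one hx
    have hsl := one_sub_ofReal_mem_slitPlane hx.2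
    exact ⟨(hasDerivAt_kummer₄ a b c hn hsl).comp_ofReal,
      (hasDerivAt_kummer₄Deriv a b c hn hsl).comp_ofReal.congr_deriv
        (solve x hx _ _ _ (kummer₄_ode hγ' hn (one_sub_ofReal_ne_zero hx.2)))⟩
  have hx₀ : (1 / 2 : ℝ) ∈ Ioo (0 : ℝ) 1 := ⟨by norm_num, by norm_num⟩
  have hW := kummer_wronskian_ne_zero hγ hγ' hs hx₀
  set A : ℂ := (F (1 / 2) * K₄' (1 / 2) - F₁ (1 / 2) * K₄ (1 / 2)) /
    (kummer₃ a b c (1 / 2 : ℝ) * kummer₄Deriv a b c (1 / 2 : ℝ) -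
      kummer₃Deriv a b c (1 / 2 : ℝ) * kummer₄ a b c (1 / 2 : ℝ)) with hA
  set B : ℂ := (K₃ (1 / 2) * F₁ (1 / 2) - K₃' (1 / 2) * F (1 / 2)) /
    (kummer₃ a b c (1 / 2 : ℝ) * kummer₄Deriv a b c (1 / 2 : ℝ) -
      kummer₃Deriv a b c (1 / 2 : ℝ) * kummer₄ a b c (1 / 2 : ℝ)) with hB
  have solV : ∀ x ∈ Ioo (0 : ℝ) 1,
      HasDerivAt (fun y => A * K₃ y + B * K₄ y) (A * K₃' x + B * K₄' x) x ∧
      HasDerivAt (fun y => A * K₃' y + B * K₄' y)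
        (p x * (A * K₃' x + B * K₄' x) + q x * (A * K₃ x + B * K₄ x)) x := by
    intro x hx
    obtain ⟨h3, h3'⟩ := sol3 x hx
    obtain ⟨h4, h4'⟩ := sol4 x hx
    exact ⟨(h3.const_mul A).add (h4.const_mul B),
      ((h3'.const_mul A).add (h4'.const_mul B)).congr_deriv (by ring)⟩
  have h0 : F (1 / 2) = A * K₃ (1 / 2) + B * K₄ (1 / 2) := by
    rw [hA, hB, div_mul_eq_mul_div, div_mul_eq_mul_div, ← add_div, eq_div_iff hW]
    simp only [hK₃, hK₃', hK₄, hK₄']; ring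
  have h1 : F₁ (1 / 2) = A * K₃' (1 / 2) + B * K₄' (1 / 2) := by
    rw [hA, hB, div_mul_eq_mul_div, div_mul_eq_mul_div, ← add_div, eq_div_iff hW]
    simp only [hK₃, hK₃', hK₄, hK₄']; ring
  obtain ⟨hE, hE'⟩ := Literature.Analysis.ODE.eqOn_of_solution_Ioo hpc hqc hx₀ solF solV h0 h1
  exact ⟨A, B, fun x hx => ⟨hE hx, hE' hx⟩⟩

end Span

/-! ### The two Gauss limits behind the coefficients -/

section Limits

variable {a b c : ℂ}

/-- **The derivative side at `1⁻`**: for `0 < Re b < Re c` and `Re(c−a−b) < 1`,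
`(1−x)^{1−(c−a−b)}·(ab/c)₂F₁(a+1,b+1;c+1;x) = (ab/c)₂F₁(c−a,c−b;c+1;x)` (Euler) tends to
`(ab/c)·Γ(c+1)Γ(1−(c−a−b))/(Γ(a+1)Γ(b+1))` (Gauss) as `x → 1⁻`. [cite: DLMF, 15.4.20] -/
theorem tendsto_cpow_mul_deriv_nhdsLT_one (hb : 0 < b.re) (hbc : b.re < c.re)
    (hs1 : (c - a - b).re < 1) :
    Tendsto (fun x : ℝ => (1 - (x : ℂ)) ^ (1 - (c - a - b)) *
        (a * b / c * ₂F₁ (a + 1) (b + 1) (c + 1) (x : ℂ))) (𝓝[<] 1)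
      (𝓝 (a * b / c * (Gamma (c + 1) * Gamma (1 - (c - a - b)) /
        (Gamma (a + 1) * Gamma (b + 1))))) := by
  have hc : 0 < c.re := hb.trans hbc
  have hcn : ∀ n : ℕ, c + 1 ≠ -n := ne_neg_nat_of_re_pos'' (by simp; linarith)
  have hG := tendsto_ordinaryHypergeometric_one (c - a) (b := c - b) (c := c + 1)
    (by simp; linarith) (by simp; linarith) (by simp at hs1 ⊢; linarith)
  rw [show c + 1 - (c - a) - (c - b) = 1 - (c - a - b) by ring, show c + 1 - (c - a) = a + 1 by ring,
    show c + 1 - (c - b) = b + 1 by ring] at hG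
  refine (hG.const_mul (a * b / c)).congr' ?_
  filter_upwards [Ioo_mem_nhdsLT (zero_lt_one' ℝ)] with x hx
  rw [ordinaryHypergeometric_euler (a := a + 1) (b := b + 1) hcn (norm_ofReal_lt_one_of_mem_Ioo hx),
    show c + 1 - (a + 1) - (b + 1) = -(1 - (c - a - b)) by ring,
    show c + 1 - (a + 1) = c - a by ring, show c + 1 - (b + 1) = c - b by ring, Complex.cpow_neg]
  have hpow : (1 - (x : ℂ)) ^ (1 - (c - a - b)) ≠ 0 :=
    cpow_ne_zero_iff.2 (Or.inl (one_sub_ofReal_ne_zero hx.2))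
  field_simp

/-- **The Euler-partner side at `1⁻`**: for `0 < Re b < Re c` and `Re(c−a−b) > −1`,
`(1−x)^{1+(c−a−b)}·((c−a)(c−b)/c)₂F₁(c−a+1,c−b+1;c+1;x) = ((c−a)(c−b)/c)₂F₁(a,b;c+1;x)` tends
to `((c−a)(c−b)/c)·Γ(c+1)Γ(1+(c−a−b))/(Γ(c−a+1)Γ(c−b+1))` as `x → 1⁻`. [cite: DLMF, 15.4.20] -/
theorem tendsto_cpow_mul_deriv_nhdsLT_one' (hb : 0 < b.re) (hbc : b.re < c.re)
    (hs2 : -1 < (c - a - b).re) :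
    Tendsto (fun x : ℝ => (1 - (x : ℂ)) ^ (1 + (c - a - b)) *
        ((c - a) * (c - b) / c * ₂F₁ (c - a + 1) (c - b + 1) (c + 1) (x : ℂ))) (𝓝[<] 1)
      (𝓝 ((c - a) * (c - b) / c * (Gamma (c + 1) * Gamma (1 + (c - a - b)) /
        (Gamma (c - a + 1) * Gamma (c - b + 1))))) := by
  have hc : 0 < c.re := hb.trans hbc
  have hcn : ∀ n : ℕ, c + 1 ≠ -n := ne_neg_nat_of_re_pos'' (by simp; linarith)
  have hG := tendsto_ordinaryHypergeometric_one a (b := b) (c := c + 1) hb (by simp; linarith)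
    (by simp at hs2 ⊢; linarith)
  rw [show c + 1 - a - b = 1 + (c - a - b) by ring, show c + 1 - a = c - a + 1 by ring,
    show c + 1 - b = c - b + 1 by ring] at hG
  refine (hG.const_mul ((c - a) * (c - b) / c)).congr' ?_
  filter_upwards [Ioo_mem_nhdsLT (zero_lt_one' ℝ)] with x hx
  rw [ordinaryHypergeometric_euler (a := c - a + 1) (b := c - b + 1) hcn
      (norm_ofReal_lt_one_of_mem_Ioo hx),
    show c + 1 - (c - a + 1) - (c - b + 1) = -(1 + (c - a - b)) by ring,
    show c + 1 - (c - a + 1) = a by ring, show c + 1 - (c - b + 1) = b by ring, Complex.cpow_neg]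
  have hpow : (1 - (x : ℂ)) ^ (1 + (c - a - b)) ≠ 0 :=
    cpow_ne_zero_iff.2 (Or.inl (one_sub_ofReal_ne_zero hx.2))
  field_simp

/-- The Gamma recursions behind `B`: `(ab/c)Γ(c+1)Γ(1−s)/(Γ(a+1)Γ(b+1)) = (a+b−c)·Γ(c)Γ(a+b−c)/(Γ(a)Γ(b))`
(`s = c−a−b ≠ 0`, `b, c ≠ 0`; both sides vanish when `a = 0` or `Γ(a)Γ(b) = 0`).
[cite: DLMF, 5.2.5] -/
theorem gamma_coeff₄_eq (hb0 : b ≠ 0) (hc0 : c ≠ 0) (hs : c - a - b ≠ 0) :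
    a * b / c * (Gamma (c + 1) * Gamma (1 - (c - a - b)) / (Gamma (a + 1) * Gamma (b + 1))) =
      (a + b - c) * (Gamma c * Gamma (a + b - c) / (Gamma a * Gamma b)) := by
  by_cases ha : a = 0
  · subst ha; simp [Complex.Gamma_zero]
  have hs' : a + b - c ≠ 0 := fun h => hs (by linear_combination -h)
  rw [show 1 - (c - a - b) = a + b - c + 1 by ring, Gamma_add_one c hc0, Gamma_add_one a ha,
    Gamma_add_one b hb0, Gamma_add_one _ hs',
    show c * Gamma c * ((a + b - c) * Gamma (a + b - c)) / (a * Gamma a * (b * Gamma b)) =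
      c * (a + b - c) / (a * b) * (Gamma c * Gamma (a + b - c) / (Gamma a * Gamma b)) by
        rw [div_mul_div_comm]; ring]
  rw [← mul_assoc]; congr 1; field_simp

/-- The Gamma recursions behind `A`:
`((c−a)(c−b)/c)Γ(c+1)Γ(1+s)/(Γ(c−a+1)Γ(c−b+1)) = s·Γ(c)Γ(s)/(Γ(c−a)Γ(c−b))`
(`s = c−a−b ≠ 0`, `c − b, c ≠ 0`). [cite: DLMF, 5.2.5] -/
theorem gamma_coeff₃_eq (hcb : c - b ≠ 0) (hc0 : c ≠ 0) (hs : c - a - b ≠ 0) :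
    (c - a) * (c - b) / c *
        (Gamma (c + 1) * Gamma (1 + (c - a - b)) / (Gamma (c - a + 1) * Gamma (c - b + 1))) =
      (c - a - b) * (Gamma c * Gamma (c - a - b) / (Gamma (c - a) * Gamma (c - b))) := by
  by_cases hca : c - a = 0
  · rw [hca, Complex.Gamma_zero]; simp
  rw [show 1 + (c - a - b) = c - a - b + 1 by ring, Gamma_add_one c hc0, Gamma_add_one _ hca,
    Gamma_add_one _ hcb, Gamma_add_one _ hs,
    show c * Gamma c * ((c - a - b) * Gamma (c - a - b)) /
        ((c - a) * Gamma (c - a) * ((c - b) * Gamma (c - b))) =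
      c * (c - a - b) / ((c - a) * (c - b)) *
        (Gamma c * Gamma (c - a - b) / (Gamma (c - a) * Gamma (c - b))) by
        rw [div_mul_div_comm]; ring]
  rw [← mul_assoc]; congr 1; field_simp

end Limits

/-! ### Identification of the coefficients -/

section Coefficients

variable {a b c : ℂ}

/-- **The coefficient of `w₄` (DLMF 15.8.4, `B = Γ(c)Γ(a+b−c)/(Γ(a)Γ(b))`)**: if
`(ab/c)₂F₁(a+1,b+1;c+1;·) = A w₃′ + B w₄′` on `(0,1)`, `0 < Re b < Re c`, `Re(c−a−b) < 1`,
`c−a−b ≠ 0`, then `× (1−x)^{1−s}` and `x → 1⁻` give `(ab/c)Γ(c+1)Γ(1−s)/(Γ(a+1)Γ(b+1)) = −sB`.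
[cite: DLMF, 15.8.4] -/
theorem connection_coeff₄ (hb : 0 < b.re) (hbc : b.re < c.re) (hs1 : (c - a - b).re < 1)
    (hs : c - a - b ≠ 0) {A B : ℂ}
    (hrep : ∀ x ∈ Ioo (0 : ℝ) 1, a * b / c * ₂F₁ (a + 1) (b + 1) (c + 1) (x : ℂ) =
      A * kummer₃Deriv a b c x + B * kummer₄Deriv a b c x) :
    B = Gamma c * Gamma (a + b - c) / (Gamma a * Gamma b) := by
  have hc : 0 < c.re := hb.trans hbc
  have hb0 : b ≠ 0 := fun h => by rw [h, zero_re] at hb; exact lt_irrefl _ hb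
  have hc0 : c ≠ 0 := fun h => by rw [h, zero_re] at hc; exact lt_irrefl _ hc
  have hL := tendsto_cpow_mul_deriv_nhdsLT_one hb hbc hs1
  have hR : Tendsto (fun x : ℝ => (1 - (x : ℂ)) ^ (1 - (c - a - b)) *
      (A * kummer₃Deriv a b c x + B * kummer₄Deriv a b c x)) (𝓝[<] 1)
      (𝓝 (A * (0 * -(a * b / (a + b - c + 1))) + B * -(c - a - b))) := by
    have h := (((tendsto_one_sub_cpow_nhdsLT_one (p := 1 - (c - a - b))
      (by simp at hs1 ⊢; linarith)).mul
      (tendsto_kummer₃Deriv_nhdsLT_one a b c)).const_mul A).add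
      ((tendsto_cpow_mul_kummer₄Deriv_nhdsLT_one a b c).const_mul B)
    exact h.congr' (Eventually.of_forall fun x => by ring)
  have hL' := hL.congr' (show _ =ᶠ[𝓝[<] (1 : ℝ)] _ from by
    filter_upwards [Ioo_mem_nhdsLT (zero_lt_one' ℝ)] with x hx using by rw [hrep x hx])
  have heq := tendsto_nhds_unique hL' hR
  rw [gamma_coeff₄_eq hb0 hc0 hs] at heq
  exact mul_left_cancel₀ (neg_ne_zero.2 hs) (by linear_combination -heq)

/-- **The coefficient of `w₃` (DLMF 15.8.4, `A = Γ(c)Γ(c−a−b)/(Γ(c−a)Γ(c−b))`)**: if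
`₂F₁(a,b;c;·) = A w₃ + B w₄` on `(0,1)`, `0 < Re b < Re c`, `Re(c−a−b) > −1`, `c−a−b ≠ 0`, then
differentiating the Euler partner `g = ₂F₁(c−a,c−b;c;·) = A(1−x)^{−s}w₃ + B w₃(c−a,c−b,c;·)`,
`× (1−x)^{1+s}`, `x → 1⁻`: `((c−a)(c−b)/c)Γ(c+1)Γ(1+s)/(Γ(c−a+1)Γ(c−b+1)) = sA`. [cite: DLMF, 15.8.4] -/
theorem connection_coeff₃ (hb : 0 < b.re) (hbc : b.re < c.re) (hs2 : -1 < (c - a - b).re)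
    (hs : c - a - b ≠ 0) {A B : ℂ}
    (hrep : ∀ x ∈ Ioo (0 : ℝ) 1, ₂F₁ a b c (x : ℂ) = A * kummer₃ a b c x + B * kummer₄ a b c x) :
    A = Gamma c * Gamma (c - a - b) / (Gamma (c - a) * Gamma (c - b)) := by
  have hc : 0 < c.re := hb.trans hbc
  have hcn : ∀ n : ℕ, c ≠ -n := ne_neg_nat_of_re_pos'' hc
  have hcb : c - b ≠ 0 := fun h => by have := congrArg Complex.re h; simp at this; linarith
  have hc0 : c ≠ 0 := fun h => by rw [h, zero_re] at hc; exact lt_irrefl _ hc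
  -- the Euler partner in the Kummer basis, its derivative two ways, `× (1−x)^{1+s}`, `x → 1⁻`
  have hg : ∀ x ∈ Ioo (0 : ℝ) 1, ₂F₁ (c - a) (c - b) c (x : ℂ) =
      A * ((1 - (x : ℂ)) ^ (-(c - a - b)) * kummer₃ a b c x) +
        B * kummer₃ (c - a) (c - b) c x := by
    intro x hx
    have h1 := one_sub_ofReal_ne_zero hx.2
    have hgx : ₂F₁ (c - a) (c - b) c (x : ℂ) = (1 - (x : ℂ)) ^ (-(c - a - b)) * ₂F₁ a b c (x : ℂ) := by
      rw [ordinaryHypergeometric_euler (a := a) (b := b) hcn (norm_ofReal_lt_one_of_mem_Ioo hx),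
        ← mul_assoc, cpow_neg, inv_mul_cancel₀ (cpow_ne_zero_iff.2 (Or.inl h1)), one_mul]
    rw [hgx, hrep x hx, ← cpow_neg_mul_kummer₄ a b c h1]
    ring
  have hg' : ∀ x ∈ Ioo (0 : ℝ) 1,
      A * (-(c - a - b) * (1 - (x : ℂ)) ^ (-(c - a - b) - 1) * (-1) * kummer₃ a b c x +
          (1 - (x : ℂ)) ^ (-(c - a - b)) * kummer₃Deriv a b c x) +
        B * kummer₃Deriv (c - a) (c - b) c x =
      (c - a) * (c - b) / c * ₂F₁ (c - a + 1) (c - b + 1) (c + 1) (x : ℂ) := by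
    intro x hx
    have hn := norm_one_sub_ofReal_lt_one hx
    have hG : HasDerivAt (fun y : ℝ => ₂F₁ (c - a) (c - b) c (y : ℂ))
        ((c - a) * (c - b) / c * ₂F₁ (c - a + 1) (c - b + 1) (c + 1) (x : ℂ)) x :=
      (hasDerivAt_ordinaryHypergeometric (norm_ofReal_lt_one_of_mem_Ioo hx)).comp_ofReal
    have hP : HasDerivAt (fun y : ℝ => (1 - (y : ℂ)) ^ (-(c - a - b)))
        (-(c - a - b) * (1 - (x : ℂ)) ^ (-(c - a - b) - 1) * (-1)) x :=
      (((hasDerivAt_id' (x : ℂ)).const_sub 1).cpow_const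
        (one_sub_ofReal_mem_slitPlane hx.2)).comp_ofReal
    have hR := ((hP.mul (hasDerivAt_kummer₃ a b c hn).comp_ofReal).const_mul A).add
      ((hasDerivAt_kummer₃ (c - a) (c - b) c hn).comp_ofReal.const_mul B)
    have hev : (fun y : ℝ => A * ((1 - (y : ℂ)) ^ (-(c - a - b)) * kummer₃ a b c y) +
        B * kummer₃ (c - a) (c - b) c y) =ᶠ[𝓝 x] fun y : ℝ => ₂F₁ (c - a) (c - b) c (y : ℂ) := by
      filter_upwards [isOpen_Ioo.mem_nhds hx] with y hy using (hg y hy).symm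
    exact hR.unique (hG.congr_of_eventuallyEq hev)
  have hL := tendsto_cpow_mul_deriv_nhdsLT_one' hb hbc hs2
  have hR : Tendsto (fun x : ℝ => (1 - (x : ℂ)) ^ (1 + (c - a - b)) *
      (A * (-(c - a - b) * (1 - (x : ℂ)) ^ (-(c - a - b) - 1) * (-1) * kummer₃ a b c x +
          (1 - (x : ℂ)) ^ (-(c - a - b)) * kummer₃Deriv a b c x) +
        B * kummer₃Deriv (c - a) (c - b) c x)) (𝓝[<] 1)
      (𝓝 (A * ((c - a - b) * 1 + 0) + B * (0 * -((c - a) * (c - b) / (c - a + (c - b) - c + 1))))) := by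
    have h := ((((tendsto_kummer₃_nhdsLT_one a b c).const_mul (c - a - b)).add
      (tendsto_one_sub_mul_kummer₃Deriv_nhdsLT_one a b c)).const_mul A).add
      (((tendsto_one_sub_cpow_nhdsLT_one (p := 1 + (c - a - b)) (by simp at hs2 ⊢; linarith)).mul
        (tendsto_kummer₃Deriv_nhdsLT_one (c - a) (c - b) c)).const_mul B)
    refine h.congr' ?_
    filter_upwards [self_mem_nhdsWithin] with x hx
    have h1 := one_sub_ofReal_ne_zero hx
    have e1 : (1 - (x : ℂ)) ^ (1 + (c - a - b)) * (1 - (x : ℂ)) ^ (-(c - a - b) - 1) = 1 := by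
      rw [← cpow_add _ _ h1, show 1 + (c - a - b) + (-(c - a - b) - 1) = 0 by ring, cpow_zero]
    have e2 : (1 - (x : ℂ)) ^ (1 + (c - a - b)) * (1 - (x : ℂ)) ^ (-(c - a - b)) = 1 - x := by
      rw [← cpow_add _ _ h1, show 1 + (c - a - b) + -(c - a - b) = 1 by ring, cpow_one]
    linear_combination (-(A * (c - a - b) * kummer₃ a b c x)) * e1 -
      (A * kummer₃Deriv a b c x) * e2
  have hL' := hL.congr' (show _ =ᶠ[𝓝[<] (1 : ℝ)] _ from by
    filter_upwards [Ioo_mem_nhdsLT (zero_lt_one' ℝ)] with x hx using by rw [← hg' x hx])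
  have heq := tendsto_nhds_unique hL' hR
  rw [gamma_coeff₃_eq hcb hc0 hs] at heq
  exact mul_left_cancel₀ hs (by linear_combination -heq)

end Coefficients

/-! ### The connection formula -/

section Connection

variable {a b c : ℂ}

/-- **The connection formula between `0` and `1`, DLMF 15.8.4 / 15.10.21**, in the Kummer basis:
for `0 < Re b < Re c`, `c−a−b ≠ 0`, `|Re(c−a−b)| < 1` and `0 < x < 1`,
`₂F₁(a,b;c;x) = Γ(c)Γ(c−a−b)/(Γ(c−a)Γ(c−b))·w₃(x) + Γ(c)Γ(a+b−c)/(Γ(a)Γ(b))·w₄(x)`, together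
with the differentiated identity. [cite: DLMF, 15.8.4] -/
theorem ordinaryHypergeometric_eq_kummer (hb : 0 < b.re) (hbc : b.re < c.re)
    (hs : c - a - b ≠ 0) (hs1 : (c - a - b).re < 1) (hs2 : -1 < (c - a - b).re) {x : ℝ}
    (hx : x ∈ Ioo (0 : ℝ) 1) :
    ₂F₁ a b c (x : ℂ) = Gamma c * Gamma (c - a - b) / (Gamma (c - a) * Gamma (c - b)) * kummer₃ a b c x +
      Gamma c * Gamma (a + b - c) / (Gamma a * Gamma b) * kummer₄ a b c x ∧
    a * b / c * ₂F₁ (a + 1) (b + 1) (c + 1) (x : ℂ) =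
      Gamma c * Gamma (c - a - b) / (Gamma (c - a) * Gamma (c - b)) * kummer₃Deriv a b c x +
      Gamma c * Gamma (a + b - c) / (Gamma a * Gamma b) * kummer₄Deriv a b c x := by
  have hcn : ∀ n : ℕ, c ≠ -n := ne_neg_nat_of_re_pos'' (hb.trans hbc)
  have hγ : ∀ n : ℕ, a + b - c + 1 ≠ -n := fun n h => by
    have h' := congrArg Complex.re h
    simp at h' hs1
    linarith [n.cast_nonneg (α := ℝ)]
  have hγ' : ∀ n : ℕ, c - a - b + 1 ≠ -n := fun n h => by
    have h' := congrArg Complex.re h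
    simp at h' hs2
    linarith [n.cast_nonneg (α := ℝ)]
  obtain ⟨A, B, hAB⟩ := exists_kummer_coefficients hcn hγ hγ' hs
  have hA := connection_coeff₃ hb hbc hs2 hs (fun y hy => (hAB y hy).1)
  have hB := connection_coeff₄ hb hbc hs1 hs (fun y hy => (hAB y hy).2)
  rw [← hA, ← hB]
  exact hAB x hx

/-- **The connection formula between `0` and `1`, DLMF 15.8.4 / 15.10.21**: for
`0 < Re b < Re c`, `c−a−b ≠ 0` with `|Re(c−a−b)| < 1` (this includes the resonant line
`Re(c−a−b) = 0`), and real `0 < x < 1`,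
`₂F₁(a,b;c;x) = Γ(c)Γ(c−a−b)/(Γ(c−a)Γ(c−b)) · ₂F₁(a,b;a+b−c+1;1−x)`
`+ Γ(c)Γ(a+b−c)/(Γ(a)Γ(b)) · (1−x)^{c−a−b} ₂F₁(c−a,c−b;c−a−b+1;1−x)`. [cite: DLMF, 15.8.4] -/
theorem ordinaryHypergeometric_connection_one (hb : 0 < b.re) (hbc : b.re < c.re)
    (hs : c - a - b ≠ 0) (hs1 : (c - a - b).re < 1) (hs2 : -1 < (c - a - b).re) {x : ℝ}
    (hx : x ∈ Ioo (0 : ℝ) 1) :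
    ₂F₁ a b c (x : ℂ) =
      Gamma c * Gamma (c - a - b) / (Gamma (c - a) * Gamma (c - b)) *
          ₂F₁ a b (a + b - c + 1) (1 - (x : ℂ)) +
        Gamma c * Gamma (a + b - c) / (Gamma a * Gamma b) *
          ((1 - (x : ℂ)) ^ (c - a - b) * ₂F₁ (c - a) (c - b) (c - a - b + 1) (1 - (x : ℂ))) := by
  rw [(ordinaryHypergeometric_eq_kummer hb hbc hs hs1 hs2 hx).1, kummer₄_eq, kummer₃]

end Connection

end Literature.Analysis.SpecialFunctions.Hypergeometric

end
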